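import Summits.FinalStateConjecture.FinalStateConjecture.Theorems.ZeroEnergyKerrOrBombStationaryLimitReductionRecutCoveringJunctionCore
import Summits.FinalStateConjecture.FinalStateConjecture.Theorems.ZeroEnergyKerrOrBombStationaryLimitReductionKerrIsometryRigidityWave3EndTopology
import HarnessLib

/-!
# Route ZeroEnergyKerrOrBomb · crux `FinalStateFromKerrOrBomb` (stmt-FinalStateConjecture-17839), line `SketchIdeator1` —
# stub `stub_recutJunctionCoreB` (m5, boost-honest junction core), wave 7: the DEEP-EXIT plumbing lemma of Step F

Helper file (`--supports stmt-FinalStateConjecture-17839`; registered helper `recutJunction_deepExit`) of the lead's wave-7 stub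
worker W18 (2026-08-17); companion of `…RecutCoreBLorentz.lean` (bricks B1a/B1b, whose conclusions enter here as HYPOTHESES).
Plan `work/stubs/W17-boost-audit.md` §7.2, Step F (F1); report `work/stubs/W18-report.md`.

Content (`recutJunction_deepExit`). Hypotheses, copied from the binder list of `SigM.stub_recutJunctionCoreB`: monotone radii,
the coordinate deepness clause (iii-c), Kerr identifications (with `cᵢ = 1`, p144329), the certified agreement clause (a_R), (e⁺);
then, as hypotheses, the conclusions of B1b (`timeᵢ ≤ lab + |cᵢ⁰| + 1` on lab-late certified coordinates), of the lateness transfer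
(`timeᵢ ≥ T*` on lab-late certified coordinates) and of the neighbour brick B3 (late certified flat ∧ d.o.c.-part coordinates are far
from hole `i`: `radiusᵢ ≥ R*`, any `R*`). Conclusion: for margins `s₀, W₀ ≥ 0` and requests `T*, R*` there is a lab time `T` such
that whenever the lab-vertical coordinate segment `t ↦ y + t e₀`, `0 ≤ t ≤ τ₁ − y⁰`, from a flat coordinate `y` with `T ≤ y⁰ ≤ τ₁`
leaves the flat domain `U₀`, its FIRST exit `yₑ = y + tₑ e₀` (`0 < tₑ`, `y⁰ + tₑ ≤ τ₁`, `y + t e₀ ∈ U₀` on `[0, tₑ)`) is, for some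
hole `i`, the moved identification point `Pᵢ Θᵢ x` of a Kerr–Schild point `x ∈ Kerr.exterior` (so a d.o.c.-part coordinate) with
`r(x) ≥ R*`, rest time `(Θᵢ x)⁰ ≥ T*`, DEEP `Aᵢ.radius (Θᵢ x) ≤ Rᵢ((Θᵢ x)⁰ − s₀) − W₀` and `(Θᵢ x)⁰ ≤ yₑ⁰ + |cᵢ⁰| + 1`; and the
same holds for the approximants `y + t e₀`, `t ∈ [tₑ − η, tₑ)` (`η > 0`), which are moreover flat coordinates at which the hole
chart and the flat chart AGREE ((a_R)). This is exactly what ingredient (α) (p141985) consumes at the exit (F1a) and what the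
prefix argument `Ψ₀ y ≤ Ψ₀ (y + t e₀) = ψᵢ (y + t e₀)` needs. Mechanism: first exit by completeness of `ℝ`; (iii-c) at the
margins `(s₀ + 1, W₀ + 2C + 1)` makes `yₑ` deep; along the lab vertical the rest-frame preimage moves by `(t − tₑ) Λᵢ⁻¹ e₀`, so
approximants within `η = 1/(‖Λᵢ⁻¹e₀‖ + 1)` stay deep at `(s₀, W₀)`; they are late flat coordinates, hence d.o.c.-part
coordinates `Pᵢ Θᵢ x'` ((e⁺)), far by B3, and `Pᵢ⁻¹ yₑ = lim Θᵢ x'` is again some `Θᵢ x̄` by the far-closure lemma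
(`kerrChartedWith_closure_of_radius_ge`: Bolzano–Weierstrass with the tilt/radius bounds of the identification). No isochrony.
Elementary; no named fact, nothing restated. Reference: Dafermos–Luk arXiv:1710.01722, Conjecture 1 (b)–(c) (late-time
multi-chart bookkeeping; formalisation-internal).
-/

set_option linter.dupNamespace false
set_option maxSynthPendingDepth 3

noncomputable section

open scoped Manifold ContDiff Topology
open Set Filter Function

namespace Summit.FinalStateConjecture.FinalStateConjecture.Theorems.SymplecticDualOfTheBomb

open Literature.Geometry.Lorentzian Summit.FinalStateConjecture.FinalStateConjecture.Theorems.OneLockedExplosion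

/-! ## §1 Coordinates of the Kerr identification and the far-closure lemma -/

section Kerr

variable {𝓑 : StationaryAFBlackHole.{0}} {A : 𝓑.AdaptedChart} {M a c r₀ : ℝ} {Θ : E4 → E4}

/-- `‖x_{space}‖ ≤ r(x) + |a|` on `{r > 0}`. [folklore] -/
private theorem spatialNorm_le_radius_add_w7 {a : ℝ} {x : E4} (hx : 0 < Kerr.radius a x) :
    E4.spatialNorm x ≤ Kerr.radius a x + |a| := by
  -- private copy of `spatialNorm_le_radius_add_w5` (…RecutCoreCOIsochronous, unbuilt today)
  have h := Kerr.norm_le_radius_add_abs (a := a) (y := E4.spatial x) (by rwa [Kerr.radius_ofTimeSpace_spatial])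
  rwa [Kerr.radius_ofTimeSpace_spatial] at h

/-- `|u⁰| ≤ ‖u‖`. [folklore] -/
private theorem abs_apply_zero_le_norm_w7 (u : E4) : |u 0| ≤ ‖u‖ := by
  refine abs_le_of_sq_le_sq ?_ (norm_nonneg _)
  rw [E4.norm_sq_eq_time_sq_add u]
  nlinarith [E4.spatialNorm_nonneg u]

/-- Two-sided radius comparison: `r(u) ≤ A.radius (Θ u) + L₂` on the Kerr exterior. [folklore] -/
private theorem radius_le_adaptedRadius_add_w7 (h : IsKerrChartedWith 𝓑 A M a c r₀ Θ) :
    ∃ L₂ : ℝ, 0 ≤ L₂ ∧ ∀ u ∈ (Kerr.exterior M a : Set E4), Kerr.radius a u ≤ A.radius (Θ u) + L₂ := by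
  -- private copy of `kerrChartedWith_radius_le_adaptedRadius_add` (…RecutCoreCOFlatSteer, unbuilt today)
  obtain ⟨hsub, -, -, -, -, -, -, -, -, -, L, hL⟩ := h
  obtain ⟨C, hC⟩ := A.exists_abs_radius_sub_spatialNorm_le
  have hrp : 0 < Kerr.rPlus M a := hsub.pos.trans_le (le_add_of_nonneg_right (Real.sqrt_nonneg _))
  refine ⟨|L| + |C| + Kerr.rPlus M a + 1, by positivity, fun u hu ↦ ?_⟩
  by_cases hfar : Kerr.rPlus M a + 1 ≤ Kerr.radius a u
  · have h1 := (abs_le.1 (hL u hu hfar).2.1).1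
    linarith [le_abs_self L, abs_nonneg C]
  · have h1 := (abs_le.1 (hC (Θ u))).1
    have h2 : 0 ≤ E4.spatialNorm (Θ u) := E4.spatialNorm_nonneg _
    linarith [le_abs_self C, abs_nonneg L, not_le.1 hfar]

/-- **Far closure at a prescribed Kerr–Schild radius.** For `IsKerrChartedWith 𝓑 A M a c r₀ Θ` with `c = 1` and
`ρ > r₊`, every limit of identification points `Θ xₙ` with `xₙ ∈ Kerr.exterior`, `r(xₙ) ≥ ρ`, is `Θ x̄` for some
`x̄ ∈ Kerr.exterior` with `r(x̄) ≥ ρ` (the `xₙ` are bounded by the tilt/radius bounds, a subsequence converges, `r ≥ ρ` is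
closed and `Θ` is continuous on the open Kerr region). [folklore] -/
theorem kerrChartedWith_closure_of_radius_ge (hW : IsKerrChartedWith 𝓑 A M a c r₀ Θ) (hc1 : c = 1) {ρ : ℝ}
    (hρ : Kerr.rPlus M a < ρ) {w : E4}
    (hw : w ∈ closure (Θ '' {x | x ∈ (Kerr.exterior M a : Set E4) ∧ ρ ≤ Kerr.radius a x})) :
    ∃ x ∈ (Kerr.exterior M a : Set E4), ρ ≤ Kerr.radius a x ∧ Θ x = w := by
  -- adapted from `kerrChartedWith_far_closure` (…RecutCoreCOIsochronous, unbuilt today)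
  obtain ⟨L₁, hL₁0, hL₁⟩ := kerrChartedWith_global_bounds hW
  obtain ⟨L₂, hL₂0, hL₂⟩ := radius_le_adaptedRadius_add_w7 hW
  obtain ⟨C, hC⟩ := A.exists_abs_radius_sub_spatialNorm_le
  obtain ⟨hsub, -, -, hr₀, hΘs, -⟩ := hW
  have hrp : 0 < Kerr.rPlus M a := hsub.pos.trans_le (le_add_of_nonneg_right (Real.sqrt_nonneg _))
  obtain ⟨ws, hws, hlim⟩ := mem_closure_iff_seq_limit.1 hw
  choose x hx hxw using hws
  have hnorm : Tendsto (fun n ↦ ‖ws n - w‖) atTop (𝓝 0) := tendsto_iff_norm_sub_tendsto_zero.1 hlim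
  obtain ⟨N, hN⟩ := eventually_atTop.1 (hnorm.eventually (gt_mem_nhds zero_lt_one))
  have hws1 : ∀ n, N ≤ n → ‖ws n‖ ≤ ‖w‖ + 1 := fun n hn ↦ by linarith [(hN n hn).le, norm_le_insert' (ws n) w]
  set B : ℝ := 2 * ‖w‖ + 2 + L₁ + |C| + L₂ + |a| with hB
  have hbound : ∀ n, N ≤ n → ‖x n‖ ≤ B := fun n hn ↦ by
    have ht := abs_le.1 ((hL₁ (x n) (hx n).1).1)
    rw [hc1, one_mul] at ht
    have h0' := abs_le.1 ((abs_apply_zero_le_norm_w7 (ws n)).trans (hws1 n hn))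
    rw [← hxw n] at h0'
    have hrad : Kerr.radius a (x n) ≤ ‖w‖ + 1 + |C| + L₂ := by
      have h1 := hL₂ (x n) (hx n).1
      have h2 := (abs_le.1 (hC (Θ (x n)))).2
      have h3 : E4.spatialNorm (Θ (x n)) ≤ ‖ws n‖ := by rw [← hxw n]; exact E4.spatialNorm_le_norm _
      linarith [hws1 n hn, le_abs_self C]
    have hsx : E4.spatialNorm (x n) ≤ Kerr.radius a (x n) + |a| :=
      spatialNorm_le_radius_add_w7 (hrp.trans (hρ.trans_le (hx n).2))
    have hxt : |x n 0| ≤ ‖w‖ + 1 + L₁ := by rw [abs_le]; constructor <;> linarith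
    have hxs : E4.spatialNorm (x n) ≤ ‖w‖ + 1 + |C| + L₂ + |a| := by linarith
    have h1 : ‖x n‖ ^ 2 ≤ B ^ 2 := by
      rw [E4.norm_sq_eq_time_sq_add (x n), hB]
      nlinarith [abs_nonneg (x n 0), E4.spatialNorm_nonneg (x n), sq_abs (x n 0), norm_nonneg w,
        abs_nonneg C, abs_nonneg a]
    exact (pow_le_pow_iff_left₀ (norm_nonneg _) (by rw [hB]; positivity) two_ne_zero).1 h1
  obtain ⟨xbar, -, φ, hφ, hconv⟩ := tendsto_subseq_of_bounded (Metric.isBounded_closedBall (x := (0 : E4)) (r := B))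
    (x := fun n ↦ x (n + N)) fun n ↦ by
      rw [Metric.mem_closedBall, dist_zero_right]; exact hbound (n + N) (Nat.le_add_left N n)
  have hrbar : ρ ≤ Kerr.radius a xbar :=
    ge_of_tendsto' (((Kerr.continuous_radius a).tendsto xbar).comp hconv) fun n ↦ (hx (φ n + N)).2
  have hxbar : xbar ∈ (Kerr.exterior M a : Set E4) :=
    Kerr.mem_exterior.2 ((max_eq_left hrp.le).trans_lt (hρ.trans_le hrbar))
  have hxreg : xbar ∈ (Kerr.region a r₀ : Set E4) :=
    Kerr.mem_region.2 ((max_le_max hr₀.le le_rfl).trans_lt (Kerr.mem_exterior.1 hxbar))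
  have hΘc : ContinuousAt Θ xbar := (hΘs.continuousOn.continuousWithinAt hxreg).continuousAt
    ((Kerr.region a r₀).isOpen.mem_nhds hxreg)
  have h1 : Tendsto (fun n ↦ Θ (x (φ n + N))) atTop (𝓝 (Θ xbar)) := hΘc.tendsto.comp hconv
  have hφN : Tendsto (fun n ↦ φ n + N) atTop atTop := (tendsto_add_atTop_nat N).comp hφ.tendsto_atTop
  have h2 : Tendsto (fun n ↦ Θ (x (φ n + N))) atTop (𝓝 w) :=
    (hlim.comp hφN).congr fun n ↦ show ws (φ n + N) = Θ (x (φ n + N)) from (hxw _).symm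
  exact ⟨xbar, hxbar, hrbar, tendsto_nhds_unique h1 h2⟩

end Kerr

/-! ## §2 First exit of a coordinate segment from an open set -/

/-- **First exit.** If the segment `t ↦ y + t e₀`, `t ∈ [0, b]`, from a point `y` of the open set `U` meets `Uᶜ`, it has a
first exit parameter `tₑ ∈ (0, b]`: `y + t e₀ ∈ U` for `t ∈ [0, tₑ)` and `y + tₑ e₀ ∉ U` (infimum of the closed set of bad
parameters). [folklore] -/
theorem exists_firstExit {U : Set E4} (hU : IsOpen U) {y : E4} (hy : y ∈ U) {b : ℝ}
    (h : ∃ t ∈ Icc (0 : ℝ) b, y + t • E4.basisVector 0 ∉ U) :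
    ∃ tₑ : ℝ, 0 < tₑ ∧ tₑ ≤ b ∧ (∀ t ∈ Ico (0 : ℝ) tₑ, y + t • E4.basisVector 0 ∈ U) ∧
      y + tₑ • E4.basisVector 0 ∉ U := by
  have hc : Continuous fun t : ℝ ↦ y + t • E4.basisVector 0 := by fun_prop
  set F : Set ℝ := Icc (0 : ℝ) b ∩ {t | y + t • E4.basisVector 0 ∉ U} with hF
  have hFc : IsClosed F := isClosed_Icc.inter ((hU.preimage hc).isClosed_compl)
  obtain ⟨t₀, ht₀, ht₀U⟩ := h
  have hne : F.Nonempty := ⟨t₀, ht₀, ht₀U⟩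
  have hbdd : BddBelow F := ⟨0, fun t ht ↦ ht.1.1⟩
  have hmem : sInf F ∈ F := hFc.csInf_mem hne hbdd
  refine ⟨sInf F, ?_, hmem.1.2, fun t ht ↦ ?_, hmem.2⟩
  · rcases hmem.1.1.eq_or_lt with h0 | h0
    · exfalso
      have h1 : y + sInf F • E4.basisVector 0 ∉ U := hmem.2
      rw [← h0, zero_smul, add_zero] at h1
      exact h1 hy
    · exact h0
  · by_contra hbad
    have h1 : sInf F ≤ t := csInf_le hbdd ⟨⟨ht.1, ht.2.le.trans hmem.1.2⟩, hbad⟩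
    linarith [ht.2]

/-! ## §3 The deep-exit lemma -/

section DeepExit

variable {𝓢 : Spacetime.{0} 4} {O : Set 𝓢.carrier} {k : ℕ}

/-- A d.o.c.-part coordinate of hole `i` has Kerr–Schild coordinates: `P⁻¹ y = Θᵢ x`, `x ∈ Kerr.exterior`. [folklore] -/
private theorem exists_kerr_of_mem_docPart_w7 (d : StationaryFinalStateDecomposition 𝓢 O k) {M a c r₀ : Fin d.N → ℝ}
    {Θ : Fin d.N → E4 → E4} {i : Fin d.N}
    (hW : IsKerrChartedWith (d.hole i) (d.adapted i) (M i) (a i) (c i) (r₀ i) (Θ i))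
    {y : (d.background i).domain} (hy : y ∈ docPart d i) :
    ∃ x ∈ (Kerr.exterior (M i) (a i) : Set E4), Θ i x = poincareInv (d.motion i).1 (d.motion i).2 y.1 := by
  -- private copy of `exists_kerr_of_mem_docPart` (…RecutCoreCOFlatSteer, unbuilt today)
  have h : poincareInv (d.motion i).1 (d.motion i).2 y.1 ∈ Θ i '' (Kerr.exterior (M i) (a i) : Set E4) := by
    rw [hW.2.2.2.2.2.2.2.2.2.1]; exact hy
  obtain ⟨x, hx, hxy⟩ := h
  exact ⟨x, hx, hxy⟩

/-- The `0`-th coordinate along the lab vertical: `(y + t e₀)⁰ = y⁰ + t`. [folklore] -/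
private theorem add_smul_basisVector_apply_zero_w7 (y : E4) (t : ℝ) :
    (y + t • E4.basisVector 0) 0 = y 0 + t := by
  simp [E4.basisVector]

/-- **Registered helper `recutJunction_deepExit` (deep-exit plumbing lemma of Step F, W17 §7.2 F1).** See the module
docstring. Hypotheses: monotone radii, (iii-c), Kerr identifications with `cᵢ = 1`, (a_R), (e⁺), the conclusions of B1b, of
the lateness transfer and of B3 (neighbour brick, as a hypothesis). Conclusion: first exit `yₑ = y + tₑ e₀` of the lab
vertical from a late flat coordinate `y` below level `τ₁`; `yₑ = Pᵢ Θᵢ x` deep, far, rest-late, `(Θᵢ x)⁰ ≤ yₑ⁰ + |cᵢ⁰| + 1`;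
the same for the approximants `y + t e₀`, `t ∈ [tₑ − η, tₑ)`, at which moreover `ψᵢ = Ψ₀`. [folklore] -/
theorem recutJunction_deepExit : ∀ {𝓢 : Spacetime.{0} 4} {O : Set 𝓢.carrier} {k : ℕ} (d : StationaryFinalStateDecomposition 𝓢 O k) (M a c r₀ : Fin d.N → ℝ) (Θ : Fin d.N → E4 → E4) (R : Fin d.N → ℝ → ℝ), (∀ i, Monotone (R i)) → (∀ W s₀ : ℝ, ∀ᶠ τ in atTop, ∀ y : E4, y 0 = τ → y ∉ (d.toOver.flatDomain : Set E4) → ∃ i, (d.background i).radius y ≤ R i ((d.background i).time y - s₀) - W) → (∀ i, IsKerrChartedWith (d.hole i) (d.adapted i) (M i) (a i) (c i) (r₀ i) (Θ i)) → (∀ i, c i = 1) → (∀ (i : Fin d.N) (y : (d.background i).domain) (h : (y : E4) ∈ d.toOver.flatDomain), d.toOver.τ₀ < (d.background i).time y.1 → d.toOver.τ₀ < (y : E4) 0 → (d.background i).radius y.1 ≤ R i ((d.background i).time y.1) → d.toOver.chart i y = d.toOver.flatChart ⟨y, h⟩) → (∀ y : d.toOver.flatDomain, d.toOver.τ₀ <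 (y : E4) 0 → ∀ i : Fin d.N, ∃ h : (y : E4) ∈ (d.background i).domain, (⟨(y : E4), h⟩ : (d.background i).domain) ∈ docPart d i) → (∀ i : Fin d.N, ∃ T : ℝ, ∀ y : E4, T ≤ y 0 → (d.background i).radius y ≤ R i ((d.background i).time y) → (d.background i).time y ≤ y 0 + |(d.motion i).2 0| + 1) → (∀ (i : Fin d.N) (Tstar : ℝ), ∃ T : ℝ, ∀ y : E4, T ≤ y 0 → (d.background i).radius y ≤ R i ((d.background i).time y) → Tstar ≤ (d.background i).time y) → (∀ (i : Fin d.N) (Rstar : ℝ), ∃ T₃ : ℝ, ∀ y : (d.background i).domain, (y : E4) ∈ (d.toOver.flatDomain : Set E4) → y ∈ docPart d i → T₃ ≤ (y : E4) 0 → T₃ ≤ (d.background i).time y.1 → (d.background i).radius y.1 ≤ R i ((d.background i).time y.1) → Rstar ≤ (d.background i).radius y.1) → ∀ s₀ W₀ Tstar Rstar : ℝ, 0 ≤ s₀ → 0 ≤ W₀ → ∃ T : ℝ, d.toOver.τ₀ < T ∧ ∀ (τ₁ : ℝ) (y : d.toOver.flatDomain), T ≤ (y : E4) 0 → (y : E4)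 0 ≤ τ₁ → (∃ t ∈ Set.Icc (0 : ℝ) (τ₁ - (y : E4) 0), (y : E4) + t • E4.basisVector 0 ∉ (d.toOver.flatDomain : Set E4)) → ∃ (i : Fin d.N) (tₑ : ℝ) (x : E4), 0 < tₑ ∧ (y : E4) 0 + tₑ ≤ τ₁ ∧ (∀ t ∈ Set.Ico (0 : ℝ) tₑ, (y : E4) + t • E4.basisVector 0 ∈ (d.toOver.flatDomain : Set E4)) ∧ (y : E4) + tₑ • E4.basisVector 0 ∉ (d.toOver.flatDomain : Set E4) ∧ x ∈ (Kerr.exterior (M i) (a i) : Set E4) ∧ ((d.motion i).1 : E4 ≃L[ℝ] E4) (Θ i x) + (d.motion i).2 = (y : E4) + tₑ • E4.basisVector 0 ∧ Rstar ≤ Kerr.radius (a i) x ∧ Tstar ≤ Θ i x 0 ∧ (d.adapted i).radius (Θ i x) ≤ R i (Θ i x 0 - s₀) - W₀ ∧ Θ i x 0 ≤ (y : E4) 0 + tₑ + |(d.motion i).2 0| + 1 ∧ ∃ η : ℝ, 0 < η ∧ η ≤ tₑ ∧ ∀ t ∈ Set.Ico (tₑ - η) tₑ, ∃ x' ∈ (Kerr.exterior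 (M i) (a i) : Set E4), ((d.motion i).1 : E4 ≃L[ℝ] E4) (Θ i x') + (d.motion i).2 = (y : E4) + t • E4.basisVector 0 ∧ Rstar ≤ Kerr.radius (a i) x' ∧ Tstar ≤ Θ i x' 0 ∧ (d.adapted i).radius (Θ i x') ≤ R i (Θ i x' 0 - s₀) - W₀ ∧ Θ i x' 0 ≤ (y : E4) 0 + t + |(d.motion i).2 0| + 1 ∧ ∀ (h : (y : E4) + t • E4.basisVector 0 ∈ (d.background i).domain) (h' : (y : E4) + t • E4.basisVector 0 ∈ (d.toOver.flatDomain : Set E4)), d.toOver.chart i ⟨(y : E4) + t • E4.basisVector 0, h⟩ = d.toOver.flatChart ⟨(y : E4) + t • E4.basisVector 0, h'⟩ := by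
  intro 𝓢 O k d M a c r₀ Θ R hRmono hRiiic hW hc1 hRa he hB1b hB1c hB3 s₀ W₀ Tstar Rstar hs₀ hW₀
  -- constants of the identifications and of the adapted radii
  have hglob := fun i ↦ kerrChartedWith_global_bounds (hW i)
  choose L₁ hL₁0 hL₁ using hglob
  choose Cr hCr using fun i ↦ (d.adapted i).exists_abs_radius_sub_spatialNorm_le
  obtain ⟨Cm', hCm'⟩ := Finite.exists_le fun i : Fin d.N ↦ |Cr i|
  set Cm : ℝ := max Cm' 0 with hCm_def
  have hCm0 : 0 ≤ Cm := le_max_right _ _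
  have hCmi : ∀ i, |Cr i| ≤ Cm := fun i ↦ (hCm' i).trans (le_max_left _ _)
  -- the target Kerr–Schild radius `ρ i` and the B3 request `ρ i + L₁ i`
  set ρ : Fin d.N → ℝ := fun i ↦ max Rstar (Kerr.rPlus (M i) (a i) + 1) with hρ_def
  have hB3' := fun i ↦ hB3 i (ρ i + L₁ i)
  choose T₃ hT₃ using hB3'
  -- rest-time requests and the lab-time thresholds of B1c, B1b
  set Ts : Fin d.N → ℝ := fun i ↦ max (max Tstar (d.toOver.τ₀ + 1)) (T₃ i) + 1 with hTs_def
  have hB1c' := fun i ↦ hB1c i (Ts i)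
  choose Tc hTc using hB1c'
  choose Tb hTb using hB1b
  obtain ⟨Tfin, hTfin⟩ := Finite.exists_le fun i ↦ max (max (Tc i) (Tb i)) (T₃ i)
  -- clause (iii-c) at the enlarged margins
  obtain ⟨Tic, hTic⟩ := eventually_atTop.1 (hRiiic (W₀ + 2 * Cm + 1) (s₀ + 1))
  set T : ℝ := max (max Tic (d.toOver.τ₀ + 1)) Tfin with hT_def
  have hT1 : Tic ≤ T := (le_max_left _ _).trans (le_max_left _ _)
  have hT2 : d.toOver.τ₀ + 1 ≤ T := (le_max_right _ _).trans (le_max_left _ _)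
  have hT3 : ∀ i, Tc i ≤ T ∧ Tb i ≤ T ∧ T₃ i ≤ T := fun i ↦
    ⟨((le_max_left _ _).trans (le_max_left _ _)).trans ((hTfin i).trans (le_max_right _ _)),
      ((le_max_right _ _).trans (le_max_left _ _)).trans ((hTfin i).trans (le_max_right _ _)),
      (le_max_right _ _).trans ((hTfin i).trans (le_max_right _ _))⟩
  refine ⟨T, by linarith, fun τ₁ y hTy hyτ hex ↦ ?_⟩
  -- §A the first exit
  obtain ⟨tₑ, htₑ0, htₑb, hIco, hye⟩ := exists_firstExit d.toOver.flatDomain.isOpen y.2 hex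
  set ye : E4 := (y : E4) + tₑ • E4.basisVector 0 with hye_def
  have hye0 : ye 0 = (y : E4) 0 + tₑ := add_smul_basisVector_apply_zero_w7 _ _
  -- §B clause (iii-c): `ye` is deep for some hole `i`
  obtain ⟨i, hdeep'⟩ := hTic (ye 0) (by rw [hye0]; linarith) ye rfl hye
  obtain ⟨hTci, hTbi, hT₃i⟩ := hT3 i
  have hrp : 0 < Kerr.rPlus (M i) (a i) :=
    (hW i).1.pos.trans_le (le_add_of_nonneg_right (Real.sqrt_nonneg _))
  -- notation for the rest-frame data of hole `i`
  have htime : ∀ z : E4, (d.background i).time z = poincareInv (d.motion i).1 (d.motion i).2 z 0 := fun z ↦ rfl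
  have hrad : ∀ z : E4, (d.background i).radius z =
      (d.adapted i).radius (poincareInv (d.motion i).1 (d.motion i).2 z) := fun z ↦ rfl
  set σe : ℝ := (d.background i).time ye with hσe
  have hCi1 : ∀ z : E4, (d.adapted i).radius z ≤ E4.spatialNorm z + Cm := fun z ↦ by
    have h := (abs_le.1 (hCr i z)).2; linarith [le_abs_self (Cr i), hCmi i]
  have hCi2 : ∀ z : E4, E4.spatialNorm z ≤ (d.adapted i).radius z + Cm := fun z ↦ by
    have h := (abs_le.1 (hCr i z)).1; linarith [le_abs_self (Cr i), hCmi i]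
  -- deepness at the requested margins and certification of `ye`
  have hdeep : (d.background i).radius ye ≤ R i (σe - s₀) - W₀ := by
    have hm : R i (σe - (s₀ + 1)) ≤ R i (σe - s₀) := hRmono i (by linarith)
    linarith
  have hcert : (d.background i).radius ye ≤ R i ((d.background i).time ye) := by
    have hm : R i (σe - s₀) ≤ R i σe := hRmono i (by linarith)
    rw [← hσe]; linarith
  -- B1c and B1b at `ye`
  have hσe1 : Ts i ≤ σe := hTc i ye (by rw [hye0]; linarith) hcert
  have hσe2 : σe ≤ ye 0 + |(d.motion i).2 0| + 1 := hTb i ye (by rw [hye0]; linarith) hcert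
  have hTs1 : max Tstar (d.toOver.τ₀ + 1) + 1 ≤ Ts i := by
    simp only [hTs_def]; linarith [le_max_left (max Tstar (d.toOver.τ₀ + 1)) (T₃ i)]
  have hTs2 : T₃ i + 1 ≤ Ts i := by
    simp only [hTs_def]; linarith [le_max_right (max Tstar (d.toOver.τ₀ + 1)) (T₃ i)]
  have hTs3 : Tstar ≤ max Tstar (d.toOver.τ₀ + 1) := le_max_left _ _
  have hTs4 : d.toOver.τ₀ + 1 ≤ max Tstar (d.toOver.τ₀ + 1) := le_max_right _ _
  -- §C the approximants `y + t e₀`, `t ∈ [tₑ − η, tₑ)`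
  set v : E4 := ((d.motion i).1 : E4 ≃L[ℝ] E4).symm (E4.basisVector 0) with hv_def
  set η : ℝ := min (1 / (‖v‖ + 1)) tₑ with hη_def
  have hη0 : 0 < η := lt_min (by positivity) htₑ0
  have hηt : η ≤ tₑ := min_le_right _ _
  have hη1 : η * (‖v‖ + 1) ≤ 1 := by
    have h1 : η ≤ 1 / (‖v‖ + 1) := min_le_left _ _
    have h2 : 0 < ‖v‖ + 1 := by positivity
    calc η * (‖v‖ + 1) ≤ 1 / (‖v‖ + 1) * (‖v‖ + 1) := by nlinarith
      _ = 1 := by field_simp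
  have hPadd : ∀ t : ℝ, poincareInv (d.motion i).1 (d.motion i).2 ((y : E4) + t • E4.basisVector 0) =
      poincareInv (d.motion i).1 (d.motion i).2 ye + (t - tₑ) • v := fun t ↦ by
    have h1 : (y : E4) + t • E4.basisVector 0 =
        ye + (t - tₑ) • ((d.motion i).1 : E4 ≃L[ℝ] E4) v := by
      rw [hv_def, ContinuousLinearEquiv.apply_symm_apply, hye_def, add_assoc, ← add_smul]
      congr 2; ring
    rw [h1, poincareInv_add_smul]
  have happrox : ∀ t ∈ Ico (tₑ - η) tₑ, ∃ x' ∈ (Kerr.exterior (M i) (a i) : Set E4),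
      Θ i x' = poincareInv (d.motion i).1 (d.motion i).2 ((y : E4) + t • E4.basisVector 0) ∧
      ρ i ≤ Kerr.radius (a i) x' ∧ Tstar ≤ Θ i x' 0 ∧
      (d.adapted i).radius (Θ i x') ≤ R i (Θ i x' 0 - s₀) - W₀ ∧
      Θ i x' 0 ≤ (y : E4) 0 + t + |(d.motion i).2 0| + 1 ∧
      ∀ (h : (y : E4) + t • E4.basisVector 0 ∈ (d.background i).domain)
        (h' : (y : E4) + t • E4.basisVector 0 ∈ (d.toOver.flatDomain : Set E4)),
        d.toOver.chart i ⟨(y : E4) + t • E4.basisVector 0, h⟩ =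
          d.toOver.flatChart ⟨(y : E4) + t • E4.basisVector 0, h'⟩ := by
    intro t ht
    have ht0 : 0 ≤ t := by linarith [ht.1]
    set yt : E4 := (y : E4) + t • E4.basisVector 0 with hyt_def
    have hyt0 : yt 0 = (y : E4) 0 + t := add_smul_basisVector_apply_zero_w7 _ _
    have hytU : yt ∈ (d.toOver.flatDomain : Set E4) := hIco t ⟨ht0, ht.2⟩
    have hytlab : d.toOver.τ₀ < yt 0 := by rw [hyt0]; linarith
    -- the rest-frame displacement is small
    have hsmall : ‖(t - tₑ) • v‖ ≤ 1 := by
      rw [norm_smul, Real.norm_eq_abs, abs_of_nonpos (by linarith [ht.2]), neg_sub]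
      have h1 : tₑ - t ≤ η := by linarith [ht.1]
      nlinarith [norm_nonneg v, h1, hη1]
    have hdiff : poincareInv (d.motion i).1 (d.motion i).2 yt - poincareInv (d.motion i).1 (d.motion i).2 ye =
        (t - tₑ) • v := by
      rw [hyt_def, hPadd t, add_sub_cancel_left]
    have hσt1 : |(d.background i).time yt - σe| ≤ 1 := by
      rw [htime, hσe, htime, ← PiLp.sub_apply, hdiff]
      exact (abs_apply_zero_le_norm_w7 _).trans hsmall
    have hσt := abs_le.1 hσt1
    have hsp : E4.spatialNorm (poincareInv (d.motion i).1 (d.motion i).2 yt) ≤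
        E4.spatialNorm (poincareInv (d.motion i).1 (d.motion i).2 ye) + 1 := by
      have h := (abs_le.1 (E4.abs_spatialNorm_sub_le (poincareInv (d.motion i).1 (d.motion i).2 yt)
        (poincareInv (d.motion i).1 (d.motion i).2 ye))).2
      rw [hdiff] at h
      linarith
    have hradt : (d.background i).radius yt ≤ (d.background i).radius ye + 2 * Cm + 1 := by
      rw [hrad, hrad]
      linarith [hCi1 (poincareInv (d.motion i).1 (d.motion i).2 yt), hCi2 (poincareInv (d.motion i).1 (d.motion i).2 ye)]
    have hdeept : (d.background i).radius yt ≤ R i ((d.background i).time yt - s₀) - W₀ := by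
      have hm : R i (σe - (s₀ + 1)) ≤ R i ((d.background i).time yt - s₀) := hRmono i (by linarith)
      linarith
    have hcertt : (d.background i).radius yt ≤ R i ((d.background i).time yt) := by
      have hm : R i ((d.background i).time yt - s₀) ≤ R i ((d.background i).time yt) := hRmono i (by linarith)
      linarith
    have hrestt : d.toOver.τ₀ < (d.background i).time yt := by linarith
    -- (e⁺): a d.o.c.-part coordinate of hole `i`, with Kerr–Schild point `x'`
    obtain ⟨hdomt, hdoct⟩ := he ⟨yt, hytU⟩ hytlab i
    obtain ⟨x', hx', hΘx'⟩ := exists_kerr_of_mem_docPart_w7 d (hW i) hdoct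
    have hΘ0 : Θ i x' 0 = (d.background i).time yt := by rw [htime, ← hΘx']
    have hΘr : (d.adapted i).radius (Θ i x') = (d.background i).radius yt := by rw [hrad, ← hΘx']
    -- B3: far from the hole
    have hfar : ρ i + L₁ i ≤ (d.background i).radius yt :=
      hT₃ i ⟨yt, hdomt⟩ hytU hdoct (by rw [hyt0]; linarith) (by linarith) hcertt
    have hρx' : ρ i ≤ Kerr.radius (a i) x' := by
      have h := (hL₁ i x' hx').2.1
      rw [hΘr] at h; linarith
    refine ⟨x', hx', hΘx', hρx', ?_, ?_, ?_, fun h h' ↦ ?_⟩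
    · rw [hΘ0]; linarith
    · rw [hΘr, hΘ0]; exact hdeept
    · rw [hΘ0, ← hyt0]
      exact hTb i yt (by rw [hyt0]; linarith) hcertt
    · exact hRa i ⟨yt, h⟩ h' hrestt hytlab hcertt
  -- §D far closure at the exit point
  haveI : (𝓝[Ico (tₑ - η) tₑ] tₑ).NeBot := by
    rw [nhdsWithin_Ico_eq_nhdsLT (by linarith)]; infer_instance
  have hgc : Continuous fun t : ℝ ↦ poincareInv (d.motion i).1 (d.motion i).2 ye + (t - tₑ) • v := by fun_prop
  have hglim : Tendsto (fun t : ℝ ↦ poincareInv (d.motion i).1 (d.motion i).2 ye + (t - tₑ) • v)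
      (𝓝[Ico (tₑ - η) tₑ] tₑ) (𝓝 (poincareInv (d.motion i).1 (d.motion i).2 ye)) := by
    have h : Tendsto (fun t : ℝ ↦ poincareInv (d.motion i).1 (d.motion i).2 ye + (t - tₑ) • v) (𝓝 tₑ)
        (𝓝 (poincareInv (d.motion i).1 (d.motion i).2 ye + (tₑ - tₑ) • v)) := hgc.tendsto tₑ
    rw [sub_self, zero_smul, add_zero] at h
    exact h.mono_left nhdsWithin_le_nhds
  have hcl : poincareInv (d.motion i).1 (d.motion i).2 ye ∈
      closure (Θ i '' {x | x ∈ (Kerr.exterior (M i) (a i) : Set E4) ∧ ρ i ≤ Kerr.radius (a i) x}) := by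
    refine mem_closure_of_tendsto hglim (eventually_nhdsWithin_of_forall fun t ht ↦ ?_)
    obtain ⟨x', hx', hΘx', hρx', -⟩ := happrox t ht
    exact ⟨x', ⟨hx', hρx'⟩, by rw [hΘx', hPadd t]⟩
  have hρi : Kerr.rPlus (M i) (a i) < ρ i := by
    have h : Kerr.rPlus (M i) (a i) + 1 ≤ ρ i := le_max_right _ _
    linarith
  obtain ⟨xbar, hxbar, hrbar, hΘbar⟩ := kerrChartedWith_closure_of_radius_ge (hW i) (hc1 i) hρi hcl
  have hΘbar0 : Θ i xbar 0 = σe := by rw [hσe, htime, ← hΘbar]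
  have hΘbarr : (d.adapted i).radius (Θ i xbar) = (d.background i).radius ye := by rw [hrad, ← hΘbar]
  have hRρ : Rstar ≤ ρ i := le_max_left _ _
  -- §E assembly
  refine ⟨i, tₑ, xbar, htₑ0, by linarith, hIco, hye, hxbar, ?_, hRρ.trans hrbar, ?_, ?_, ?_, η, hη0, hηt,
    fun t ht ↦ ?_⟩
  · rw [hΘbar, apply_poincareInv_add]
  · rw [hΘbar0]; linarith
  · rw [hΘbarr, hΘbar0]; exact hdeep
  · rw [hΘbar0, ← hye0]; exact hσe2
  · obtain ⟨x', hx', hΘx', hρx', hT', hd', hb', ha'⟩ := happrox t ht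
    exact ⟨x', hx', by rw [hΘx', apply_poincareInv_add], hRρ.trans hρx', hT', hd', hb', ha'⟩

end DeepExit

end Summit.FinalStateConjecture.FinalStateConjecture.Theorems.SymplecticDualOfTheBomb

end
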